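import Summits.BirchSwinnertonDyer.Rank1Residual.X11b.TorsionCohomologyControl
import HarnessLib

/-!
# X11b, route R1 — erratum Lemma 2.1 in kernel form: `Sel(M[r]) ≅ Sel(M)[r]`

HONEST FRAMING (cell `b2b-bsdres`, run/shared/lean/b2b/bsd-rank1-residual/, verbatim in every
file): the goal of the cell is to DELETE the COMBINATION-SHAPED residual classes of the
Birch–Swinnerton-Dyer formula for ALL analytic-rank `≤ 1` elliptic curves over `ℚ` — "full BSD
formula for every rank `≤ 1` curve in class `C`" assembled STRICTLY from published theorems — so
that the rank-`≤ 1` remainder becomes exactly the CONSTRUCTION-SHAPED classes, which are TYPED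
(missing-input `Prop`s), NOT attempted. This is not "finishing BSD". Sub-cell
`b2b-bsdres-multr1-p1` (X11b via the re-proof of Castella 2018 Thm. A along the author's erratum):
a RESEARCH ROUTE; no claim beyond the stated class; X11b stays CONSTRUCTION-SHAPED; nothing here
changes a label. No named fact is introduced (definitions with bodies and theorems only; no
`sorry`).

## What this file kernel-checks (erratum Lemma 2.1, text quoted in `TorsionCohomologyControl.lean`)

Setting: a topological group `Γ`, a family of continuous homomorphisms `φ_v : Γ_v → Γ` (`v : ι`)
and a set `L ⊆ ι` of CONSTRAINED indices; a discrete `A`-linear `Γ`-module `M`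
(`ContinuousRep Γ A M`, `[DiscreteTopology M]`). The **Selmer group** `selmer φ L ρ ⊆ H¹(Γ, M)` is
the `A`-submodule of classes whose restriction along `φ_v` vanishes for every `v ∈ L` (no
condition at `v ∉ L`). Dictionary: `Γ = G_{K,S}`, `S = Σ ∪ S_p ⊇` the ramification of `T_g`,
`Γ_𝔭̄ = G_{K_𝔭̄}`, `L = {𝔭̄}`, `M = M_g = T_g ⊗ Λ_𝒪^*`, `A = Λ_𝒪` (or `𝒪`), `r = ϖ^m` (`p^m`):
then `selmer φ L ρ = ker {H¹(G_{K,S}, M_g) → H¹(K_𝔭̄, M_g)} = Sel^Σ_𝔭̄(K, M_g)` in the form used by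
the erratum's proof ("By our assumption on `Σ`, the Selmer groups … are submodules of
`H¹(G_{K,S}, M_g)` …; `Sel^Σ_𝔭̄(K, M_g)[ϖ^m]` is the kernel of the composite map
`H¹(G_{K,S}, M_g[p^m]) → H¹(K_𝔭̄, M_g[ϖ^m]) → H¹(K_𝔭̄, M_g)[ϖ^m]`"; the identification of
[Cas18, Def. 2.2]'s Selmer group with this kernel for `S ⊇ Σ ∪ S_p ∪ ram(T)` is [Cas18, display in
the proof of Thm. 2.6] and is NOT re-proved here — with `Γ = G_K` and
`L = {𝔭̄} ∪ {w ∤ p, w ∉ Σ}` one gets the displayed definition literally, at the price of the local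
hypothesis below at every constrained `w`).

* `resH1 ρ φ` (`res_φ : H¹(Γ, M) → H¹(Γ_v, M)`, Mathlib `ContinuousCohomology.map φ`),
  `restrictHom`, **naturality** `resH1_cohomologyMap` (`res ∘ H¹(Γ, f) = H¹(Γ_v, f) ∘ res`),
  degree-`1` functoriality `cohomologyMap_comp_one` / `cohomologyMap_id_one`, `H¹` of an
  isomorphism is bijective, `isoOfLinearEquiv` (an `A`-linear equivariant bijection of discrete
  modules is an isomorphism — the shape of input (b));
* `selmer`, `mem_selmer_iff`, `cohomologyMap_mem_selmer` (functoriality),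
  `mem_selmer_of_cohomologyMap_mem` (descent under constrained-local injectivity),
  `selmerCongr` (**`Sel(M₁) ≃ₗ[A] Sel(M₂)` along `M₁ ≅ M₂`**);
* **`map_torsionInclH1_selmer`**: for `r`-divisible `M` with `r`-divisible constrained-local
  invariants `M^{Γ_v}` (`v ∈ L`), `H¹(ι)(Sel(M[r])) = Sel(M) ∩ H¹(Γ, M)[r]`;
* **`selmerTorsionEquiv`**: if moreover `M^Γ` is `r`-divisible (e.g. `= 0`), `H¹(ι)` induces
  **`Sel(M[r]) ≃ₗ[A] Sel(M)[r]`** — Lemma 2.1.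

The hypotheses are exactly the erratum's, in module-theoretic form: "`H⁰(K, M_g) = 0`" (global;
from Shapiro's lemma + irreducibility of `ρ̄_g|_{G_K}` — INPUT, not re-proved) and
"`H⁰(K_𝔭̄, M_g)/ϖ^m H⁰(K_𝔭̄, M_g) = 0` … when so does `H⁰(K_𝔭̄, A_g[ϖ])`" (local at the constrained
place; the reduction to the `ϖ`-torsion is `TorsionControl.invariants_eq_bot_of_torsionBy`, the
further reduction from `M_g[ϖ]` to `A_g[ϖ]` through the unipotent `G_{K_𝔭̄}`-module `Λ_𝒪^*[ϖ]` is
INPUT). The arithmetic objects (`G_{K,S}`, `M_g`) are not constructed in the tree; the theorems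
are stated for the abstract data. Downstream: `CastellaErratumSelmerCongruence.lean` feeds
`selmerTorsionEquiv` + `selmerCongr` + Pontryagin duality into the congruence-limit skeleton.
CONDITIONAL on nothing; deletes nothing; X11b stays CONSTRUCTION-SHAPED.

References: F. Castella, Erratum, Lemma 2.1 [Castella2018Erratum]; F. Castella, Camb. J. Math. 6
(2018), §2.1, proof of Thm. 2.6 [Castella2018]; J.-P. Serre, *Galois Cohomology*, I §2.2–2.4
[SerreGaloisCohomology1997].
-/

noncomputable section

open CategoryTheory Literature.NumberTheory.GaloisRepresentations
open scoped ContRepresentation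

universe u

namespace Summit.BirchSwinnertonDyer.Rank1Residual.X11b.TorsionControl

variable {A : Type*} [CommRing A] [TopologicalSpace A]
variable {Γ : Type u} [Group Γ] [TopologicalSpace Γ]
variable {H : Type u} [Group H] [TopologicalSpace H]
variable {M : Type u} [AddCommGroup M] [Module A M] [TopologicalSpace M] [DiscreteTopology M]
  [ContinuousSMul A M]
variable {M₁ : Type u} [AddCommGroup M₁] [Module A M₁] [TopologicalSpace M₁] [DiscreteTopology M₁]
  [ContinuousSMul A M₁]
variable {M₂ : Type u} [AddCommGroup M₂] [Module A M₂] [TopologicalSpace M₂] [DiscreteTopology M₂]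
  [ContinuousSMul A M₂]
variable {M₃ : Type u} [AddCommGroup M₃] [Module A M₃] [TopologicalSpace M₃] [DiscreteTopology M₃]
  [ContinuousSMul A M₃]

/-! ### Restriction along a continuous homomorphism `φ : H → Γ` (decomposition groups) -/

section Restriction

/-- The identity of `M` as a morphism from `ρ` restricted along `φ` (Mathlib `TopRep.res`) to the
tree's `ρ.restrict φ` (the two agree definitionally). [folklore] -/
def resMod (ρ : ContinuousRep Γ A M) (φ : H →ₜ* Γ) :
    TopRep.res (φ : H →* Γ) ρ.toTopRep ⟶ (ρ.restrict φ).toTopRep :=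
  TopRep.ofHom ⟨ContinuousLinearMap.id A M, fun _ => rfl⟩

/-- Unfolding `resMod`. [folklore] -/
@[simp] theorem resMod_hom_apply (ρ : ContinuousRep Γ A M) (φ : H →ₜ* Γ) (m : M) :
    (resMod ρ φ).hom m = m := rfl

/-- A morphism of discrete `Γ`-modules restricted along `φ : H → Γ` (same underlying map).
[folklore] -/
def restrictHom (φ : H →ₜ* Γ) {ρ₁ : ContinuousRep Γ A M₁} {ρ₂ : ContinuousRep Γ A M₂}
    (f : ρ₁.toTopRep ⟶ ρ₂.toTopRep) : (ρ₁.restrict φ).toTopRep ⟶ (ρ₂.restrict φ).toTopRep :=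
  TopRep.ofHom ⟨f.hom.toContinuousLinearMap, fun h => f.hom.isIntertwining' (φ h)⟩

/-- Unfolding `restrictHom`. [folklore] -/
@[simp] theorem restrictHom_hom_apply (φ : H →ₜ* Γ) {ρ₁ : ContinuousRep Γ A M₁}
    {ρ₂ : ContinuousRep Γ A M₂} (f : ρ₁.toTopRep ⟶ ρ₂.toTopRep) (m : M₁) :
    (restrictHom φ f).hom m = f.hom m := rfl

/-- `restrictHom` is compatible with composition. [folklore] -/
theorem restrictHom_comp (φ : H →ₜ* Γ) {ρ₁ : ContinuousRep Γ A M₁} {ρ₂ : ContinuousRep Γ A M₂}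
    {ρ₃ : ContinuousRep Γ A M₃} (f : ρ₁.toTopRep ⟶ ρ₂.toTopRep) (g : ρ₂.toTopRep ⟶ ρ₃.toTopRep) :
    restrictHom φ (f ≫ g) = restrictHom φ f ≫ restrictHom φ g := rfl

/-- `restrictHom` of the identity. [folklore] -/
theorem restrictHom_id (φ : H →ₜ* Γ) (ρ₁ : ContinuousRep Γ A M₁) :
    restrictHom φ (𝟙 ρ₁.toTopRep) = 𝟙 (ρ₁.restrict φ).toTopRep := rfl

/-- Restricting the torsion subrepresentation: `(M[r])|_H = (M|_H)[r]` and `ι|_H = ι`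
(definitional). [folklore] -/
theorem restrictHom_torsionIncl (φ : H →ₜ* Γ) (ρ : ContinuousRep Γ A M) (r : A) :
    restrictHom φ (torsionIncl ρ r) = torsionIncl (ρ.restrict φ) r := rfl

variable [IsTopologicalGroup Γ] [IsTopologicalGroup H]

/-- **The restriction map `res_φ : H¹(Γ, M) → H¹(H, M)`** along `φ : H → Γ` (Mathlib
`ContinuousCohomology.map φ`; for `φ` the inclusion of a decomposition group this is
localisation at the corresponding place). [cite: SerreGaloisCohomology1997, I §2.4] -/
abbrev resH1 (ρ : ContinuousRep Γ A M) (φ : H →ₜ* Γ) :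
    continuousCohomology 1 ρ.toTopRep ⟶ continuousCohomology 1 (ρ.restrict φ).toTopRep :=
  ContinuousCohomology.map φ (resMod ρ φ) 1

/-- **Naturality of restriction in the module**: `res_φ ∘ H¹(Γ, f) = H¹(H, f|_H) ∘ res_φ`
(both send `[c]` to `[h ↦ f (c (φ h))]`). [cite: SerreGaloisCohomology1997, I §2.4] -/
theorem resH1_cohomologyMap (φ : H →ₜ* Γ) {ρ₁ : ContinuousRep Γ A M₁} {ρ₂ : ContinuousRep Γ A M₂}
    (f : ρ₁.toTopRep ⟶ ρ₂.toTopRep) (x : continuousCohomology 1 ρ₁.toTopRep) :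
    resH1 ρ₂ φ (cohomologyMap f 1 x) = cohomologyMap (restrictHom φ f) 1 (resH1 ρ₁ φ x) := by
  obtain ⟨c, rfl⟩ := oneCocycleClass_surjective _ x
  rw [cohomologyMap_oneCocycleClass, map_oneCocycleClass, map_oneCocycleClass,
    cohomologyMap_oneCocycleClass]
  exact congrArg _ (Subtype.ext (ContinuousMap.ext fun σ => rfl))

/-- Functoriality of `H¹` in the module, on classes (degree-`1` pointwise form of Mathlib's
`ContinuousCohomology.map_comp`). [folklore] -/
theorem cohomologyMap_comp_one {ρ₁ : ContinuousRep Γ A M₁} {ρ₂ : ContinuousRep Γ A M₂}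
    {ρ₃ : ContinuousRep Γ A M₃} (f : ρ₁.toTopRep ⟶ ρ₂.toTopRep) (g : ρ₂.toTopRep ⟶ ρ₃.toTopRep)
    (x : continuousCohomology 1 ρ₁.toTopRep) :
    cohomologyMap (f ≫ g) 1 x = cohomologyMap g 1 (cohomologyMap f 1 x) := by
  obtain ⟨c, rfl⟩ := oneCocycleClass_surjective _ x
  rw [cohomologyMap_oneCocycleClass, cohomologyMap_oneCocycleClass, cohomologyMap_oneCocycleClass]
  exact congrArg _ (Subtype.ext (ContinuousMap.ext fun σ => rfl))

/-- `H¹(𝟙) = id` on classes. [folklore] -/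
theorem cohomologyMap_id_one (ρ₁ : ContinuousRep Γ A M₁) (x : continuousCohomology 1 ρ₁.toTopRep) :
    cohomologyMap (𝟙 ρ₁.toTopRep) 1 x = x := by
  obtain ⟨c, rfl⟩ := oneCocycleClass_surjective _ x
  rw [cohomologyMap_oneCocycleClass]
  exact congrArg _ (Subtype.ext (ContinuousMap.ext fun σ => rfl))

/-- `H¹` of an isomorphism of discrete `Γ`-modules is injective. [folklore] -/
theorem cohomologyMap_injective_of_iso {ρ₁ : ContinuousRep Γ A M₁} {ρ₂ : ContinuousRep Γ A M₂}
    (e : ρ₁.toTopRep ≅ ρ₂.toTopRep) : Function.Injective (cohomologyMap e.hom 1) := by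
  intro x x' h
  have := congrArg (cohomologyMap e.inv 1) h
  rwa [← cohomologyMap_comp_one, ← cohomologyMap_comp_one, e.hom_inv_id, cohomologyMap_id_one,
    cohomologyMap_id_one] at this

/-- `H¹` of an isomorphism of discrete `Γ`-modules is surjective. [folklore] -/
theorem cohomologyMap_surjective_of_iso {ρ₁ : ContinuousRep Γ A M₁} {ρ₂ : ContinuousRep Γ A M₂}
    (e : ρ₁.toTopRep ≅ ρ₂.toTopRep) : Function.Surjective (cohomologyMap e.hom 1) := fun y =>
  ⟨cohomologyMap e.inv 1 y, by
    rw [← cohomologyMap_comp_one, e.inv_hom_id, cohomologyMap_id_one]⟩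

/-- The restriction along `φ` of an isomorphism of discrete `Γ`-modules is an isomorphism of
discrete `H`-modules. [folklore] -/
def restrictIso (φ : H →ₜ* Γ) {ρ₁ : ContinuousRep Γ A M₁} {ρ₂ : ContinuousRep Γ A M₂}
    (e : ρ₁.toTopRep ≅ ρ₂.toTopRep) : (ρ₁.restrict φ).toTopRep ≅ (ρ₂.restrict φ).toTopRep where
  hom := restrictHom φ e.hom
  inv := restrictHom φ e.inv
  hom_inv_id := by rw [← restrictHom_comp, e.hom_inv_id, restrictHom_id]
  inv_hom_id := by rw [← restrictHom_comp, e.inv_hom_id, restrictHom_id]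

omit [IsTopologicalGroup Γ] in
/-- An `A`-linear `Γ`-equivariant bijection of discrete `Γ`-modules is an isomorphism of the attached
topological representations (continuity is automatic). This is the shape in which input (b) of the
erratum ("an isomorphism `T_{g_m}/p^m T_{g_m} ≃ T/p^m T` as `𝒪[G_ℚ]`-modules", whence
`M_{g_m}[p^m] ≃ M_f[p^m]`) enters. [folklore] -/
def isoOfLinearEquiv {ρ₁ : ContinuousRep Γ A M₁} {ρ₂ : ContinuousRep Γ A M₂} (θ : M₁ ≃ₗ[A] M₂)
    (hθ : ∀ (g : Γ) (m : M₁), θ (ρ₁ g m) = ρ₂ g (θ m)) : ρ₁.toTopRep ≅ ρ₂.toTopRep where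
  hom := TopRep.ofHom ⟨⟨θ.toLinearMap, continuous_of_discreteTopology⟩, fun g => by
    ext m; exact hθ g m⟩
  inv := TopRep.ofHom ⟨⟨θ.symm.toLinearMap, continuous_of_discreteTopology⟩, fun g => by
    ext m
    apply θ.injective
    change θ (θ.symm (ρ₂ g m)) = θ (ρ₁ g (θ.symm m))
    rw [hθ, θ.apply_symm_apply, θ.apply_symm_apply]⟩
  hom_inv_id := by ext m; exact θ.symm_apply_apply m
  inv_hom_id := by ext m; exact θ.apply_symm_apply m

end Restriction

/-! ### Selmer groups cut out by vanishing of restrictions, and their control -/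

section Selmer

variable [IsTopologicalGroup Γ]
variable {ι : Type*} {Γv : ι → Type u} [∀ v, Group (Γv v)] [∀ v, TopologicalSpace (Γv v)]
  [∀ v, IsTopologicalGroup (Γv v)] (φ : ∀ v, Γv v →ₜ* Γ) (L : Set ι)

/-- **The Selmer group of `(Γ, (φ_v)_{v ∈ L})` with coefficients in `M`**: the classes of
`H¹(Γ, M)` restricting to zero along `φ_v : Γ_v → Γ` for every `v ∈ L` (no condition at
`v ∉ L`). For `Γ = G_{K,S}` (`S = Σ ∪ S_p`), `Γ_v = G_{K_v}` and `L = {𝔭̄}` this is the erratum's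
`Sel^Σ_𝔭̄(K, M) = ker {H¹(G_{K,S}, M) → H¹(K_𝔭̄, M)}` ([Cas18, §2.1, display before Thm. 2.6]); for
`Γ = G_K` and `L = {𝔭̄} ∪ {w ∤ p, w ∉ Σ}` it is the displayed definition of erratum §2 /
[Cas18, Def. 2.2] (zero local conditions away from `Σ ∪ {𝔭}`).
[cite: Castella2018Erratum, §2 (definition of Sel^Σ)] -/
def selmer (ρ : ContinuousRep Γ A M) : Submodule A (continuousCohomology 1 ρ.toTopRep) :=
  ⨅ v ∈ L, LinearMap.ker (resH1 ρ (φ v)).hom.toLinearMap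

/-- Membership in `selmer`: all constrained restrictions vanish. [folklore] -/
theorem mem_selmer_iff (ρ : ContinuousRep Γ A M) (x : continuousCohomology 1 ρ.toTopRep) :
    x ∈ selmer φ L ρ ↔ ∀ v ∈ L, resH1 ρ (φ v) x = 0 := by
  simp only [selmer, Submodule.mem_iInf, LinearMap.mem_ker]
  rfl

/-- `H¹(f)` maps `Sel(M₁)` into `Sel(M₂)` (naturality of restriction). [folklore] -/
theorem cohomologyMap_mem_selmer {ρ₁ : ContinuousRep Γ A M₁} {ρ₂ : ContinuousRep Γ A M₂}
    (f : ρ₁.toTopRep ⟶ ρ₂.toTopRep) {x : continuousCohomology 1 ρ₁.toTopRep}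
    (hx : x ∈ selmer φ L ρ₁) : cohomologyMap f 1 x ∈ selmer φ L ρ₂ := by
  rw [mem_selmer_iff] at hx ⊢
  intro v hv
  rw [resH1_cohomologyMap, hx v hv, map_zero]

/-- Conversely, if every constrained local map `H¹(Γ_v, M₁) → H¹(Γ_v, M₂)` is injective, a class
whose image lies in `Sel(M₂)` lies in `Sel(M₁)`. [folklore] -/
theorem mem_selmer_of_cohomologyMap_mem {ρ₁ : ContinuousRep Γ A M₁} {ρ₂ : ContinuousRep Γ A M₂}
    (f : ρ₁.toTopRep ⟶ ρ₂.toTopRep)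
    (hinj : ∀ v ∈ L, Function.Injective (cohomologyMap (restrictHom (φ v) f) 1))
    {x : continuousCohomology 1 ρ₁.toTopRep} (hx : cohomologyMap f 1 x ∈ selmer φ L ρ₂) :
    x ∈ selmer φ L ρ₁ := by
  rw [mem_selmer_iff] at hx ⊢
  intro v hv
  apply hinj v hv
  rw [← resH1_cohomologyMap, hx v hv, map_zero]

/-- **Selmer groups along an isomorphism of coefficients**: `Sel(M₁) ≃ Sel(M₂)` for
`M₁ ≅ M₂` (used with (b): `M_{g_m}[p^m] ≅ M_f[p^m]`). [folklore] -/
def selmerCongr {ρ₁ : ContinuousRep Γ A M₁} {ρ₂ : ContinuousRep Γ A M₂}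
    (e : ρ₁.toTopRep ≅ ρ₂.toTopRep) : selmer φ L ρ₁ ≃ₗ[A] selmer φ L ρ₂ :=
  LinearEquiv.ofBijective
    (((cohomologyMap e.hom 1).hom.toLinearMap.domRestrict (selmer φ L ρ₁)).codRestrict
      (selmer φ L ρ₂) fun x => cohomologyMap_mem_selmer φ L e.hom x.2)
    ⟨fun x x' h => Subtype.ext (cohomologyMap_injective_of_iso e (congrArg Subtype.val h)),
      fun y => by
        obtain ⟨x, hx⟩ := cohomologyMap_surjective_of_iso e y.1
        have hxS : x ∈ selmer φ L ρ₁ :=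
          mem_selmer_of_cohomologyMap_mem φ L e.hom
            (fun v _ => cohomologyMap_injective_of_iso (restrictIso (φ v) e)) (by rw [hx]; exact y.2)
        exact ⟨⟨x, hxS⟩, Subtype.ext hx⟩⟩

/-- Unfolding `selmerCongr`: the underlying map is `H¹(e)`. [folklore] -/
@[simp] theorem selmerCongr_apply_coe {ρ₁ : ContinuousRep Γ A M₁} {ρ₂ : ContinuousRep Γ A M₂}
    (e : ρ₁.toTopRep ≅ ρ₂.toTopRep) (x : selmer φ L ρ₁) :
    (selmerCongr φ L e x : continuousCohomology 1 ρ₂.toTopRep) = cohomologyMap e.hom 1 x := rfl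

variable (ρ : ContinuousRep Γ A M) (r : A)

/-- **Erratum Lemma 2.1, kernel form.** Let `M` be a discrete `A`-linear `Γ`-module on which
`r ∈ A` acts surjectively, with `r`-divisible invariants `M^Γ` (e.g. `M^Γ = 0`: "`H⁰(K, M_g) = 0`
by Shapiro's lemma and irreducibility") and, for every constrained `v ∈ L`, `r`-divisible local
invariants `M^{Γ_v}` ("`H⁰(K_𝔭̄, M_g)/ϖ^m H⁰(K_𝔭̄, M_g)` … vanishes when so does
`H⁰(K_𝔭̄, A_g[ϖ])`"). Then `H¹(ι)` maps `Sel(M[r])` onto `Sel(M)[r] = Sel(M) ∩ H¹(Γ, M)[r]`.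
[cite: Castella2018Erratum, Lemma 2.1] -/
theorem map_torsionInclH1_selmer (hr : Function.Surjective fun m : M => r • m)
    (hloc : ∀ v ∈ L, ∀ w ∈ ((ρ.restrict (φ v)).toTopRep).ρ.invariants,
      ∃ w' ∈ ((ρ.restrict (φ v)).toTopRep).ρ.invariants, r • w' = w) :
    Submodule.map (torsionInclH1 ρ r) (selmer φ L (torsionRep ρ r)) =
      selmer φ L ρ ⊓ Submodule.torsionBy A (continuousCohomology 1 ρ.toTopRep) r := by
  ext y
  rw [Submodule.mem_map, Submodule.mem_inf, Submodule.mem_torsionBy_iff]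
  constructor
  · rintro ⟨x, hx, rfl⟩
    exact ⟨cohomologyMap_mem_selmer φ L (torsionIncl ρ r) hx, smul_cohomologyMap_torsionIncl ρ r x⟩
  · rintro ⟨hy, hry⟩
    obtain ⟨x, rfl⟩ := exists_cohomologyMap_torsionIncl_eq ρ r hr y hry
    exact ⟨x, mem_selmer_of_cohomologyMap_mem φ L (torsionIncl ρ r)
      (fun v hv => cohomologyMap_torsionIncl_injective (ρ.restrict (φ v)) r hr (hloc v hv)) hy, rfl⟩

/-- **Erratum Lemma 2.1, kernel form (the isomorphism)**: under the hypotheses of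
`map_torsionInclH1_selmer` and `r`-divisibility of the global invariants `M^Γ`, `H¹(ι)` induces
an `A`-linear isomorphism `Sel(M[r]) ≃ Sel(M)[r]` — "the inclusion `M_g[ϖ^m] ⊂ M_g` induces an
isomorphism `Sel^Σ_𝔭̄(K, M_g[ϖ^m]) ≃ Sel^Σ_𝔭̄(K, M_g)[ϖ^m]`".
[cite: Castella2018Erratum, Lemma 2.1] -/
def selmerTorsionEquiv (hr : Function.Surjective fun m : M => r • m)
    (hglob : ∀ w ∈ ρ.toTopRep.ρ.invariants, ∃ w' ∈ ρ.toTopRep.ρ.invariants, r • w' = w)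
    (hloc : ∀ v ∈ L, ∀ w ∈ ((ρ.restrict (φ v)).toTopRep).ρ.invariants,
      ∃ w' ∈ ((ρ.restrict (φ v)).toTopRep).ρ.invariants, r • w' = w) :
    selmer φ L (torsionRep ρ r) ≃ₗ[A] Submodule.torsionBy A (selmer φ L ρ) r :=
  LinearEquiv.ofBijective
    ((((torsionInclH1 ρ r).domRestrict (selmer φ L (torsionRep ρ r))).codRestrict (selmer φ L ρ)
      fun x => cohomologyMap_mem_selmer φ L (torsionIncl ρ r) x.2).codRestrict
      (Submodule.torsionBy A (selmer φ L ρ) r) fun x =>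
        (Submodule.mem_torsionBy_iff r _).2 (Subtype.ext (smul_cohomologyMap_torsionIncl ρ r x.1)))
    ⟨fun x x' h => Subtype.ext (cohomologyMap_torsionIncl_injective ρ r hr hglob
        (congrArg (fun z => ((z : Submodule.torsionBy A (selmer φ L ρ) r) : selmer φ L ρ).1) h)),
      fun y => by
        have hy : (y : selmer φ L ρ).1 ∈ Submodule.map (torsionInclH1 ρ r)
            (selmer φ L (torsionRep ρ r)) := by
          rw [map_torsionInclH1_selmer φ L ρ r hr hloc, Submodule.mem_inf, Submodule.mem_torsionBy_iff]
          exact ⟨(y : selmer φ L ρ).2,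
            congrArg Subtype.val ((Submodule.mem_torsionBy_iff r _).1 y.2)⟩
        obtain ⟨x, hx, hxy⟩ := hy
        exact ⟨⟨x, hx⟩, Subtype.ext (Subtype.ext hxy)⟩⟩

/-- Unfolding `selmerTorsionEquiv`: the underlying map is `H¹(ι)`. [folklore] -/
@[simp] theorem selmerTorsionEquiv_apply_coe_coe (hr : Function.Surjective fun m : M => r • m)
    (hglob : ∀ w ∈ ρ.toTopRep.ρ.invariants, ∃ w' ∈ ρ.toTopRep.ρ.invariants, r • w' = w)
    (hloc : ∀ v ∈ L, ∀ w ∈ ((ρ.restrict (φ v)).toTopRep).ρ.invariants,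
      ∃ w' ∈ ((ρ.restrict (φ v)).toTopRep).ρ.invariants, r • w' = w)
    (x : selmer φ L (torsionRep ρ r)) :
    (((selmerTorsionEquiv φ L ρ r hr hglob hloc x : Submodule.torsionBy A (selmer φ L ρ) r) :
      selmer φ L ρ) : continuousCohomology 1 ρ.toTopRep) = cohomologyMap (torsionIncl ρ r) 1 x :=
  rfl

end Selmer

end Summit.BirchSwinnertonDyer.Rank1Residual.X11b.TorsionControl

end
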